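import Mathlib.GroupTheory.Commutator.Basic
import Mathlib.GroupTheory.OrderOfElement
import Mathlib.Tactic.Group
import Literature.NumberTheory.FaltingsSerre.ResidualRigidity
import HarnessLib

/-!
# Residual rigidity for image `S₃ ≀ S₂` (BPPTVY `N = 353`): the outer class is killed by one trace

[BPPTVY, §7.2 p. 1190] (`N = 353`): "the two residual images are isomorphic and absolutely
irreducible (recall that there are two embeddings of `S₃ ≀ C₂` into `GSp₄(𝔽₂)` up to inner
automorphisms, and they differ in the trace of order `3` and `6` elements)"; [BPPTVY, §5.1
p. 1173]: the outer automorphism of `S₆` "interchanges the trace of some order `3` and order `6`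
elements"; [BPPTVY, Lemma 5.1.7 p. 1174]: `S₃ ≀ S₂` (order `72`) is one of the nine absolutely
irreducible subgroups of `Sp₄(𝔽₂) ≃ S₆`, unique up to conjugacy.

This file is the `S₃ ≀ S₂` companion of `ResidualRigidity.lean` (images `S₅(b)`, `S₆`): it derives
Step 1 of [BPPTVY, Algorithm 2.2.3] — `Certificate.residual_eq`, `ρ̄_A ≃ ρ̄_f` — from ROUTE-T field
data when the common image is `W = S₃ ≀ S₂ = Stab_{S₆}({1,2,3} ⊔ {4,5,6})`
(`= ⟨(1 2 3), (1 2), (1 4)(2 5)(3 6)⟩ = Subgroup.closure (Set.range gensS3wrS2)`):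

* **same kernel** (`ker σ₁ = ker σ₂`, i.e. the same `2`-division field),
* `σ₁(Γ)` is (an `Sp₄(𝔽₂)`-conjugate of) `ι(W)` and `σ₂` is symplectic,
* ONE datum: `tr σ₁(u) = tr σ₂(u)` at an element `u` with `σ₁(u)` of order `3` or `6`
  (`σ₁(u)⁶ = 1`, `σ₁(u)² ≠ 1`; in the pipeline `u = Frob_p` at a prime where `L_p(A,T) mod 2` is
  `1+T+T³+T⁴` or `1+T²+T⁴`),

conclude `σ₂ = ι(π) σ₁ ι(π)⁻¹` (`exists_conj_of_ker_iff_of_range_S3wrS2`).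

## Method (kernel facts on `S₆`, all single-quantifier `decide +kernel`)

`W` is generated by `a = (1 2 3)(4 5)` and `b = (1 4)(2 5)(3 6)` with `b² = (ab)⁴ = [a,b]² = 1`.
`Aut(W)` has order `144 = 2·#W` and `W` is self-normalising in `S₆`, so an injection
`W ↪ S₆` with image conjugate to `W` is, up to `S₆`-conjugacy, the inclusion or the inclusion
twisted by the outer class; the kernel distinguishes them by the cycle type of the image `x` of `a`
(order `6`): `x` of type `3·2·1` ⇒ after conjugating `x = a`, every `y` with
`y² = (ay)⁴ = [a,y]² = 1` is `C(a)`-conjugate to `b` (`exists_conj_pair_W`: the embedding is inner);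
`x` a `6`-cycle ⇒ after conjugating `x = (1 4 2 5 3 6)`, for every such `y` and EVERY element
`g ∈ W` of order `3` or `6` (as one of `72` words in `a, b`) the same word in `x, y` has the
opposite fixed-letter parity, i.e. the opposite trace under `ι` by (5.1.8)
(`twisted_parity_flip`) — contradicting the datum.  No automorphism group is constructed.

## References
* [BPPTVY] A. Brumer, A. Pacetti, C. Poor, G. Tornaría, J. Voight, D. S. Yuen, *On the paramodularity
  of typical abelian surfaces*, Algebra Number Theory 13:5 (2019): §7.2 p. 1190 (`N = 353`), §5.1
  (5.1.8) p. 1173, Lemma 5.1.7 p. 1174, Algorithm 2.2.3 Step 1. [cite: BrumerEtAl2019]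
-/

namespace Literature.NumberTheory.FaltingsSerre.GSp4F2

open Equiv Equiv.Perm
open scoped commutatorElement

/-! ### A. Kernel facts: `W = S₃ ≀ S₂ = ⟨(1 2 3)(4 5), (1 4)(2 5)(3 6)⟩ ≤ S₆` -/

/-- `a = (1 2 3)(4 5) ∈ W`, an element of order `6` of cycle type `3·2·1`. [cite: BrumerEtAl2019, Lemma 5.1.7 p. 1174] -/
def c123t45 : Perm (Fin 6) := c123 * swap (3 : Fin 6) 4

/-- The `6`-cycle `(1 4 2 5 3 6)` (image of `a` under a non-inner embedding `W ↪ S₆`). [folklore] -/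
def c142536 : Perm (Fin 6) := c[(0 : Fin 6), 3, 1, 4, 2, 5]

/-- The generating pair `a = (1 2 3)(4 5)`, `b = (1 4)(2 5)(3 6)` of `W`. [cite: BrumerEtAl2019, Lemma 5.1.7 p. 1174] -/
def gensW : Fin 2 → Perm (Fin 6) := ![c123t45, bswap]

/-- The `72` elements of `W` as words in `a` (letter `0`) and `b` (letter `1`). [folklore] -/
def wordsW : List (List (Fin 2)) :=
  [[], [0], [1], [0, 0], [0, 1], [1, 0], [0, 0, 0], [0, 0, 1],
   [0, 1, 0], [1, 0, 0], [1, 0, 1], [0, 0, 0, 0], [0, 0, 0, 1], [0, 0, 1, 0], [0, 1, 0, 0], [0, 1, 0, 1],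
   [1, 0, 0, 0], [1, 0, 0, 1], [1, 0, 1, 0], [0, 0, 0, 0, 0], [0, 0, 0, 0, 1], [0, 0, 0, 1, 0], [0, 0, 1, 0, 0], [0, 0, 1, 0, 1],
   [0, 1, 0, 0, 0], [0, 1, 0, 0, 1], [0, 1, 0, 1, 0], [1, 0, 0, 0, 0], [1, 0, 0, 0, 1], [1, 0, 0, 1, 0], [1, 0, 1, 0, 0], [1, 0, 1, 0, 1],
   [0, 0, 0, 0, 0, 1], [0, 0, 0, 0, 1, 0], [0, 0, 0, 1, 0, 0], [0, 0, 0, 1, 0, 1], [0, 0, 1, 0, 0, 0], [0, 0, 1, 0, 0, 1], [0, 0, 1, 0, 1, 0], [0, 1, 0, 0, 0, 0],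
   [0, 1, 0, 0, 0, 1], [0, 1, 0, 0, 1, 0], [0, 1, 0, 1, 0, 0], [0, 1, 0, 1, 0, 1], [1, 0, 0, 0, 0, 1], [1, 0, 0, 0, 1, 0], [1, 0, 1, 0, 0, 0], [0, 0, 0, 0, 0, 1, 0],
   [0, 0, 0, 0, 1, 0, 0], [0, 0, 0, 1, 0, 0, 0], [0, 0, 0, 1, 0, 0, 1], [0, 0, 0, 1, 0, 1, 0], [0, 0, 1, 0, 0, 0, 0], [0, 0, 1, 0, 0, 0, 1], [0, 0, 1, 0, 0, 1, 0], [0, 0, 1, 0, 1, 0, 1],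
   [0, 1, 0, 1, 0, 0, 0], [1, 0, 0, 0, 1, 0, 0], [1, 0, 0, 0, 1, 0, 1], [1, 0, 1, 0, 0, 0, 1], [0, 0, 0, 0, 0, 1, 0, 0], [0, 0, 0, 0, 1, 0, 0, 0], [0, 0, 0, 0, 1, 0, 0, 1], [0, 0, 0, 1, 0, 0, 0, 0],
   [0, 0, 0, 1, 0, 0, 0, 1], [0, 0, 0, 1, 0, 0, 1, 0], [0, 0, 0, 1, 0, 1, 0, 1], [0, 1, 0, 1, 0, 0, 0, 1], [1, 0, 0, 0, 1, 0, 1, 0], [0, 0, 0, 0, 0, 1, 0, 0, 1], [0, 0, 0, 0, 1, 0, 0, 0, 0], [0, 0, 0, 0, 1, 0, 0, 1, 0]]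

/-- The `72` elements of `W`. [folklore] -/
def elemsW : List (Perm (Fin 6)) := wordsW.map (evalWord gensW)

/-- KERNEL CHECK: `1 ∈ W` (the empty word). [folklore] -/
theorem one_mem_elemsW : (1 : Perm (Fin 6)) ∈ elemsW := by
  unfold elemsW wordsW gensW evalWord c123t45 c123 bswap
  decide +kernel

/-- KERNEL CHECK: the `72` words are closed under right multiplication by `a` and `b`. [folklore] -/
theorem elemsW_mul_gens : ∀ x ∈ elemsW, x * c123t45 ∈ elemsW ∧ x * bswap ∈ elemsW := by
  unfold elemsW wordsW gensW evalWord c123t45 c123 bswap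
  decide +kernel

/-- KERNEL CHECK: the `72` words are exactly the permutations preserving the block system
`{1,2,3} ⊔ {4,5,6}`, i.e. `W = S₃ ≀ S₂`. [cite: BrumerEtAl2019, Lemma 5.1.7 p. 1174] -/
theorem mem_elemsW_iff_blocks : ∀ g : Perm (Fin 6), g ∈ elemsW ↔
    ((∀ i : Fin 6, (i : ℕ) < 3 → ((g i : Fin 6) : ℕ) < 3) ∨
      (∀ i : Fin 6, (i : ℕ) < 3 → 3 ≤ ((g i : Fin 6) : ℕ))) := by
  unfold elemsW wordsW gensW evalWord c123t45 c123 bswap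
  decide +kernel

/-- KERNEL CHECK: the defining relations `b² = (ab)⁴ = [a,b]² = 1` used below. [folklore] -/
theorem rel_c123t45_bswap : bswap ^ 2 = 1 ∧ (c123t45 * bswap) ^ 4 = 1 ∧ ⁅c123t45, bswap⁆ ^ 2 = 1 := by
  unfold c123t45 c123 bswap
  refine ⟨?_, ?_, ?_⟩ <;> decide +kernel

/-- KERNEL CHECK: `a` has order `6`. [folklore] -/
theorem c123t45_pow : c123t45 ^ 6 = 1 ∧ c123t45 ^ 2 ≠ 1 ∧ c123t45 ^ 3 ≠ 1 := by
  unfold c123t45 c123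
  refine ⟨?_, ?_, ?_⟩ <;> decide +kernel

/-- KERNEL CHECK: translation between `(a, b)` and the printed-style generators
`(1 2 3), (1 2), (1 4)(2 5)(3 6)` of `gensS3wrS2`. [folklore] -/
theorem gensS3wrS2_words : t12 = bswap * c123t45 ^ 3 * bswap ∧ c123 = c123t45 ^ 4 ∧
    c123t45 = c123 * (bswap * t12 * bswap) := by
  unfold c123t45 c123 bswap t12
  refine ⟨?_, ?_, ?_⟩ <;> decide +kernel

/-- KERNEL CHECK: an element of order `6` fixing the letter `6` is conjugate to `a = (1 2 3)(4 5)`. [folklore] -/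
theorem exists_conj_eq_c123t45_of_apply_five : ∀ x : Perm (Fin 6), x 5 = 5 → x ^ 6 = 1 → x ^ 2 ≠ 1 →
    x ^ 3 ≠ 1 → ∃ g : Perm (Fin 6), g * x * g⁻¹ = c123t45 := by
  unfold c123t45 c123
  decide +kernel

/-- KERNEL CHECK: a fixed-point-free element of order `6` with `6 ↦ 1` is conjugate to
`(1 4 2 5 3 6)`. [folklore] -/
theorem exists_conj_eq_c142536_of_apply_five : ∀ x : Perm (Fin 6), x 5 = 0 → x ^ 6 = 1 → x ^ 2 ≠ 1 →
    x ^ 3 ≠ 1 → (∀ z, x z ≠ z) → ∃ g : Perm (Fin 6), g * x * g⁻¹ = c142536 := by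
  unfold c142536
  decide +kernel

set_option synthInstance.maxSize 2048 in
/-- KERNEL CHECK (**inner class**): with `x = a`, every `y` satisfying the relations of `b` is
`C(a)`-conjugate to `b` — an embedding `W ↪ S₆` sending `a` to an element of type `3·2·1` is
the restriction of an inner automorphism. [cite: BrumerEtAl2019, §7.2 p. 1190] -/
theorem exists_conj_pair_W : ∀ y : Perm (Fin 6), y ^ 2 = 1 → (c123t45 * y) ^ 4 = 1 →
    ⁅c123t45, y⁆ ^ 2 = 1 → ∃ π : Perm (Fin 6), π * c123t45 * π⁻¹ = c123t45 ∧ π * bswap * π⁻¹ = y := by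
  unfold c123t45 c123 bswap
  decide +kernel

set_option synthInstance.maxSize 2048 in
/-- KERNEL CHECK (**outer class flips the trace of order-`3` and order-`6` elements**): with `x` the
`6`-cycle `(1 4 2 5 3 6)` and `y` satisfying the relations of `b`, for every one of the `72` words
`g = w(a,b) ∈ W` of order `3` or `6`, `w(x,y)` has a fixed letter iff `g` has none — by (5.1.8)
(`trace_iota_eq_card_fixed`) the traces of `ι(g)` and `ι(w(x,y))` differ. [cite: BrumerEtAl2019, §7.2 p. 1190, §5.1 p. 1173] -/
theorem twisted_parity_flip : ∀ y : Perm (Fin 6), y ^ 2 = 1 → (c142536 * y) ^ 4 = 1 →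
    ⁅c142536, y⁆ ^ 2 = 1 → ∀ w ∈ wordsW, evalWord gensW w ^ 6 = 1 → evalWord gensW w ^ 2 ≠ 1 →
      ((∃ z, evalWord ![c142536, y] w z = z) ↔ ∀ z, evalWord gensW w z ≠ z) := by
  unfold wordsW gensW evalWord c142536 c123t45 c123 bswap
  decide +kernel

/-- KERNEL CHECK (**(5.1.8) as a fixed-letter criterion, orders `3` and `6`**): for `v ∈ S₆` with
`v⁶ = 1 ≠ v²` (cycle types `3·1³`, `3²`, `3·2·1`, `6`), `v` has a fixed letter iff `#Fix(v)` is
odd, i.e. iff `tr ι(v) = 1`. [cite: BrumerEtAl2019, Lemma 5.1.5 / (5.1.8) p. 1173] -/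
theorem exists_fixed_iff_card_fixed_odd₆ : ∀ v : Perm (Fin 6), v ^ 6 = 1 → v ^ 2 ≠ 1 →
    ((∃ z, v z = z) ↔ (((Finset.univ.filter fun x => v x = x).card : ℕ) : ZMod 2) = 1) := by
  decide +kernel

/-! ### B. Consequences in `S₆` -/

/-- A fixed letter of `g x g⁻¹` gives one of `x`. [folklore] -/
theorem fixed_of_conj_fixed {g x : Perm (Fin 6)} {z : Fin 6} (h : (g * x * g⁻¹) z = z) :
    x (g⁻¹ z) = g⁻¹ z := by
  apply g.injective
  rw [Perm.mul_apply, Perm.mul_apply] at h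
  rw [h]
  show z = (g * g⁻¹) z
  rw [mul_inv_cancel, Perm.one_apply]

/-- Having a fixed letter is a conjugacy invariant. [folklore] -/
theorem exists_fixed_conj_iff (g x : Perm (Fin 6)) : (∃ z, (g * x * g⁻¹) z = z) ↔ ∃ z, x z = z := by
  constructor
  · rintro ⟨z, hz⟩
    exact ⟨g⁻¹ z, fixed_of_conj_fixed hz⟩
  · rintro ⟨z, hz⟩
    refine ⟨g z, ?_⟩
    show g (x ((g⁻¹ * g) z)) = g z
    rw [inv_mul_cancel, Perm.one_apply, hz]

/-- An element of order `6` with a fixed letter is conjugate to `a = (1 2 3)(4 5)`. [folklore] -/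
theorem exists_conj_eq_c123t45 {x : Perm (Fin 6)} (h6 : x ^ 6 = 1) (h2 : x ^ 2 ≠ 1) (h3 : x ^ 3 ≠ 1)
    (hz : ∃ z, x z = z) : ∃ g : Perm (Fin 6), g * x * g⁻¹ = c123t45 := by
  obtain ⟨z, hz⟩ := hz
  have h5 : (swap (5 : Fin 6) z * x * (swap (5 : Fin 6) z)⁻¹) 5 = 5 := by
    rw [swap_inv, Perm.mul_apply, Perm.mul_apply, swap_apply_left, hz, swap_apply_right]
  obtain ⟨g, hg⟩ := exists_conj_eq_c123t45_of_apply_five _ h5 (by rw [conj_pow, h6, conj_eq_one_iff])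
    (by rw [conj_pow, Ne, conj_eq_one_iff]; exact h2) (by rw [conj_pow, Ne, conj_eq_one_iff]; exact h3)
  exact ⟨g * swap 5 z, by rw [← hg]; group⟩

/-- A fixed-point-free element of order `6` is conjugate to `(1 4 2 5 3 6)`. [folklore] -/
theorem exists_conj_eq_c142536 {x : Perm (Fin 6)} (h6 : x ^ 6 = 1) (h2 : x ^ 2 ≠ 1) (h3 : x ^ 3 ≠ 1)
    (hz : ∀ z, x z ≠ z) : ∃ g : Perm (Fin 6), g * x * g⁻¹ = c142536 := by
  set s : Perm (Fin 6) := swap (0 : Fin 6) (x 5) with hs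
  have h5 : (s * x * s⁻¹) 5 = 0 := by
    rw [hs, swap_inv, Perm.mul_apply, Perm.mul_apply, swap_apply_of_ne_of_ne (by decide) (hz 5).symm,
      swap_apply_right]
  obtain ⟨g, hg⟩ := exists_conj_eq_c142536_of_apply_five _ h5 (by rw [conj_pow, h6, conj_eq_one_iff])
    (by rw [conj_pow, Ne, conj_eq_one_iff]; exact h2) (by rw [conj_pow, Ne, conj_eq_one_iff]; exact h3)
    (fun z h => hz _ (fixed_of_conj_fixed h))
  exact ⟨g * s, by rw [← hg]; group⟩

/-- `⟨(1 2 3), (1 2), (1 4)(2 5)(3 6)⟩ = ⟨a, b⟩`. [cite: BrumerEtAl2019, Lemma 5.1.7 p. 1174] -/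
theorem closure_gensS3wrS2_eq :
    Subgroup.closure (Set.range gensS3wrS2) = Subgroup.closure ({c123t45, bswap} : Set (Perm (Fin 6))) := by
  obtain ⟨ht, hc, ha⟩ := gensS3wrS2_words
  apply le_antisymm
  · rw [Subgroup.closure_le]
    have hA : c123t45 ∈ Subgroup.closure ({c123t45, bswap} : Set (Perm (Fin 6))) :=
      Subgroup.subset_closure (Set.mem_insert _ _)
    have hB : bswap ∈ Subgroup.closure ({c123t45, bswap} : Set (Perm (Fin 6))) :=
      Subgroup.subset_closure (Set.mem_insert_of_mem _ (Set.mem_singleton _))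
    rintro _ ⟨i, rfl⟩
    fin_cases i
    · show c123 ∈ _
      rw [hc]; exact Subgroup.pow_mem _ hA 4
    · show t12 ∈ _
      rw [ht]; exact Subgroup.mul_mem _ (Subgroup.mul_mem _ hB (Subgroup.pow_mem _ hA 3)) hB
    · show bswap ∈ _
      exact hB
  · rw [Subgroup.closure_le]
    have h0 : c123 ∈ Subgroup.closure (Set.range gensS3wrS2) := Subgroup.subset_closure ⟨0, rfl⟩
    have h1 : t12 ∈ Subgroup.closure (Set.range gensS3wrS2) := Subgroup.subset_closure ⟨1, rfl⟩
    have h2 : bswap ∈ Subgroup.closure (Set.range gensS3wrS2) := Subgroup.subset_closure ⟨2, rfl⟩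
    rintro x hx
    rcases hx with rfl | rfl
    · rw [SetLike.mem_coe, ha]
      exact Subgroup.mul_mem _ h0 (Subgroup.mul_mem _ (Subgroup.mul_mem _ h2 h1) h2)
    · exact h2

/-- Every element of `⟨a, b⟩` right-multiplies the word list into itself (finite group: the
subgroup closure is the submonoid closure). [folklore] -/
theorem mul_mem_elemsW_of_mem_closure {g : Perm (Fin 6)}
    (hg : g ∈ Subgroup.closure ({c123t45, bswap} : Set (Perm (Fin 6)))) :
    ∀ x ∈ elemsW, x * g ∈ elemsW := by
  have hg' : g ∈ (Subgroup.closure ({c123t45, bswap} : Set (Perm (Fin 6)))).toSubmonoid := hg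
  rw [Subgroup.closure_toSubmonoid_of_finite] at hg'
  clear hg
  induction hg' using Submonoid.closure_induction with
  | mem s hs =>
    intro x hx
    rcases hs with rfl | rfl
    · exact (elemsW_mul_gens x hx).1
    · exact (elemsW_mul_gens x hx).2
  | one => intro x hx; rwa [mul_one]
  | mul a b _ _ ha hb => intro x hx; rw [← mul_assoc]; exact hb _ (ha _ hx)

/-- **`W = ⟨a, b⟩` is the set of the `72` words.** [folklore] -/
theorem exists_word_of_mem_closure {g : Perm (Fin 6)}
    (hg : g ∈ Subgroup.closure ({c123t45, bswap} : Set (Perm (Fin 6)))) :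
    ∃ w ∈ wordsW, evalWord gensW w = g := by
  have h := mul_mem_elemsW_of_mem_closure hg 1 one_mem_elemsW
  rw [one_mul] at h
  unfold elemsW at h
  rw [List.mem_map] at h
  exact h

/-- Conversely every word lies in `W`; so `g ∈ W ↔ g` preserves the blocks `{1,2,3} ⊔ {4,5,6}`. [cite: BrumerEtAl2019, Lemma 5.1.7 p. 1174] -/
theorem mem_closure_gensS3wrS2_iff_blocks (g : Perm (Fin 6)) :
    g ∈ Subgroup.closure (Set.range gensS3wrS2) ↔
      ((∀ i : Fin 6, (i : ℕ) < 3 → ((g i : Fin 6) : ℕ) < 3) ∨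
        (∀ i : Fin 6, (i : ℕ) < 3 → 3 ≤ ((g i : Fin 6) : ℕ))) := by
  rw [← mem_elemsW_iff_blocks, closure_gensS3wrS2_eq]
  constructor
  · intro hg
    obtain ⟨w, hw, rfl⟩ := exists_word_of_mem_closure hg
    exact List.mem_map.2 ⟨w, hw, rfl⟩
  · intro hg
    unfold elemsW at hg
    obtain ⟨w, -, rfl⟩ := List.mem_map.1 hg
    have h := evalWord_mem gensW w
    have hr : Set.range gensW = {c123t45, bswap} := by
      ext x
      simp only [gensW, Set.mem_range, Set.mem_insert_iff, Set.mem_singleton_iff]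
      constructor
      · rintro ⟨i, rfl⟩; fin_cases i
        · exact Or.inl rfl
        · exact Or.inr rfl
      · rintro (rfl | rfl); exacts [⟨0, rfl⟩, ⟨1, rfl⟩]
    rwa [hr] at h

/-! ### C. Words in an arbitrary group -/

/-- The element denoted by a word `w` in letters `g` of any monoid. [folklore] -/
def evalWordIn {M : Type*} [Monoid M] {m : ℕ} (g : Fin m → M) (w : List (Fin m)) : M :=
  (w.map g).prod

/-- A homomorphism evaluates words letterwise. [folklore] -/
theorem map_evalWordIn {M N : Type*} [Monoid M] [Monoid N] {m : ℕ} (f : M →* N) (g : Fin m → M)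
    (w : List (Fin m)) : f (evalWordIn g w) = evalWordIn (f ∘ g) w := by
  unfold evalWordIn
  rw [map_list_prod, List.map_map]

/-- `f ∘ (a, b) = (f a, f b)`. [folklore] -/
theorem comp_vecCons₂ {α β : Type*} (f : α → β) (a b : α) : f ∘ ![a, b] = ![f a, f b] := by
  ext i
  fin_cases i <;> rfl

/-! ### D. Transport along `ker σ₁ = ker σ₂` (permutation level) -/

section Perm

variable {Γ : Type*} [Group Γ]

/-- **Rigidity, image `S₃ ≀ S₂`, normalised form.**  `σ₁(Γ) = W = ⟨(1 2 3), (1 2), (1 4)(2 5)(3 6)⟩`,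
`ker σ₁ = ker σ₂`, and at one `u` with `σ₁(u)` of order `3` or `6` the permutations `σ₁(u)`,
`σ₂(u)` both have or both lack a fixed letter (= equal traces under `ι`) ⇒ `σ₂ = π σ₁ π⁻¹`.
The non-inner embedding is excluded by `twisted_parity_flip`. [cite: BrumerEtAl2019, §7.2 p. 1190, §5.1 p. 1173] -/
theorem exists_conj_of_ker_iff_of_range_eq_S3wrS2 {σ₁ σ₂ : Γ →* Perm (Fin 6)}
    (hker : ∀ γ, σ₁ γ = 1 ↔ σ₂ γ = 1)
    (h₁ : σ₁.range = Subgroup.closure (Set.range gensS3wrS2))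
    {u : Γ} (hu6 : σ₁ u ^ 6 = 1) (hu2 : σ₁ u ^ 2 ≠ 1)
    (hfix : (∃ z, σ₁ u z = z) ↔ ∃ z, σ₂ u z = z) :
    ∃ π : Perm (Fin 6), ∀ γ, σ₂ γ = π * σ₁ γ * π⁻¹ := by
  rw [closure_gensS3wrS2_eq] at h₁
  have hsurj : ∀ s ∈ Subgroup.closure ({c123t45, bswap} : Set (Perm (Fin 6))), ∃ γ, σ₁ γ = s :=
    fun s hs => by rw [← h₁] at hs; exact hs
  obtain ⟨p, hp⟩ := hsurj c123t45 (Subgroup.subset_closure (Set.mem_insert _ _))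
  obtain ⟨q, hq⟩ := hsurj bswap (Subgroup.subset_closure (Set.mem_insert_of_mem _ (Set.mem_singleton _)))
  obtain ⟨A6, A2, A3⟩ := c123t45_pow
  obtain ⟨R1, R2, R3⟩ := rel_c123t45_bswap
  -- kernel-equality transport, for `σ₂` replaced by any conjugate `g σ₂ g⁻¹`
  have hk : ∀ g : Perm (Fin 6), ∀ γ, σ₁ γ = 1 ↔ conjHom g σ₂ γ = 1 := fun g γ => by
    rw [conjHom_eq_one_iff]; exact hker γ
  have hrel : ∀ g : Perm (Fin 6), conjHom g σ₂ p ^ 6 = 1 ∧ conjHom g σ₂ p ^ 2 ≠ 1 ∧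
      conjHom g σ₂ p ^ 3 ≠ 1 ∧ conjHom g σ₂ q ^ 2 = 1 ∧ (conjHom g σ₂ p * conjHom g σ₂ q) ^ 4 = 1 ∧
      ⁅conjHom g σ₂ p, conjHom g σ₂ q⁆ ^ 2 = 1 := by
    intro g
    have T := map_eq_iff_of_ker_iff (hk g)
    refine ⟨?_, ?_, ?_, ?_, ?_, ?_⟩
    · have h := (T (p ^ 6) 1).1 (by rw [map_pow, map_one, hp]; exact A6)
      rwa [map_pow, map_one] at h
    · intro h
      have h' := (T (p ^ 2) 1).2 (by rw [map_pow, map_one]; exact h)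
      rw [map_pow, map_one, hp] at h'
      exact A2 h'
    · intro h
      have h' := (T (p ^ 3) 1).2 (by rw [map_pow, map_one]; exact h)
      rw [map_pow, map_one, hp] at h'
      exact A3 h'
    · have h := (T (q ^ 2) 1).1 (by rw [map_pow, map_one, hq]; exact R1)
      rwa [map_pow, map_one] at h
    · have h := (T ((p * q) ^ 4) 1).1 (by rw [map_pow, map_mul, map_one, hp, hq]; exact R2)
      rwa [map_pow, map_mul, map_one] at h
    · have h := (T (⁅p, q⁆ ^ 2) 1).1
        (by rw [map_pow, map_commutatorElement, map_one, hp, hq]; exact R3)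
      rwa [map_pow, map_commutatorElement, map_one] at h
  have hgen : ∀ γ, σ₁ γ ∈ Subgroup.closure (σ₁ '' {p, q}) := fun γ => by
    rw [Set.image_pair, hp, hq, ← h₁]; exact ⟨γ, rfl⟩
  -- from a normalising `g` and a `π` conjugating the generators, conclude
  have finish : ∀ g π : Perm (Fin 6), conjHom g σ₂ p = π * c123t45 * π⁻¹ →
      conjHom g σ₂ q = π * bswap * π⁻¹ → ∃ ϖ : Perm (Fin 6), ∀ γ, σ₂ γ = ϖ * σ₁ γ * ϖ⁻¹ := by
    intro g π hgp hgq
    have hall := conj_of_conj_on_generators (hk g) π {p, q} (by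
      intro x hx
      rcases hx with rfl | rfl
      · rw [hp, hgp]
      · rw [hq, hgq]) hgen
    refine ⟨g⁻¹ * π, fun γ => ?_⟩
    have hγ := hall γ
    rw [conjHom_apply] at hγ
    calc σ₂ γ = g⁻¹ * (g * σ₂ γ * g⁻¹) * g := by group
      _ = g⁻¹ * (π * σ₁ γ * π⁻¹) * g := by rw [hγ]
      _ = (g⁻¹ * π) * σ₁ γ * (g⁻¹ * π)⁻¹ := by group
  obtain ⟨X6, X2, X3, -, -, -⟩ := hrel 1
  have h1p : conjHom 1 σ₂ p = σ₂ p := by rw [conjHom_apply, one_mul, inv_one, mul_one]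
  rw [h1p] at X6 X2 X3
  by_cases hxz : ∃ z, σ₂ p z = z
  · -- the embedding is inner
    obtain ⟨g, hg⟩ := exists_conj_eq_c123t45 X6 X2 X3 hxz
    have hgp : conjHom g σ₂ p = c123t45 := by rw [conjHom_apply]; exact hg
    obtain ⟨-, -, -, S1, S2, S3⟩ := hrel g
    rw [hgp] at S2 S3
    obtain ⟨π, hπa, hπb⟩ := exists_conj_pair_W (conjHom g σ₂ q) S1 S2 S3
    exact finish g π (by rw [hgp, hπa]) hπb.symm
  · -- the embedding is twisted by the outer class: contradiction with the datum at `u`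
    exfalso
    have hxz' : ∀ z, σ₂ p z ≠ z := fun z hz => hxz ⟨z, hz⟩
    obtain ⟨g, hg⟩ := exists_conj_eq_c142536 X6 X2 X3 hxz'
    have hgp : conjHom g σ₂ p = c142536 := by rw [conjHom_apply]; exact hg
    obtain ⟨-, -, -, S1, S2, S3⟩ := hrel g
    rw [hgp] at S2 S3
    obtain ⟨w, hw, hwu⟩ := exists_word_of_mem_closure
      (show σ₁ u ∈ Subgroup.closure ({c123t45, bswap} : Set (Perm (Fin 6))) by
        rw [← h₁]; exact ⟨u, rfl⟩)
    have T := map_eq_iff_of_ker_iff (hk g)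
    have e1 : σ₁ (evalWordIn ![p, q] w) = σ₁ u := by
      rw [map_evalWordIn, comp_vecCons₂, hp, hq, ← hwu]; rfl
    have e2 : conjHom g σ₂ u = evalWord ![c142536, conjHom g σ₂ q] w := by
      rw [← (T _ _).1 e1, map_evalWordIn, comp_vecCons₂, hgp]; rfl
    have flip := twisted_parity_flip (conjHom g σ₂ q) S1 S2 S3 w hw (by rw [hwu]; exact hu6)
      (by rw [hwu]; exact hu2)
    rw [← e2, hwu] at flip
    have hc := exists_fixed_conj_iff g (σ₂ u)
    rw [← conjHom_apply] at hc
    have h := hfix.trans (hc.symm.trans flip)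
    rcases em (∃ z, σ₁ u z = z) with hP | hP
    · obtain ⟨z, hz⟩ := hP
      exact (h.1 ⟨z, hz⟩) z hz
    · exact hP (h.2 (not_exists.1 hP))

end Perm

/-! ### E. Matrix level: `σ : Γ → GL₄(𝔽₂)` with image conjugate to `ι(W)` -/

section MatrixLevel

variable {Γ : Type*} [Group Γ]

/-- **Residual rigidity, printed `353` form (matrix level).**  `σ₁(Γ)` an `Sp₄(𝔽₂)`-conjugate of
`ι(S₃ ≀ S₂)`, `σ₂` symplectic with the same kernel, and `tr σ₁(u) = tr σ₂(u)` at one `u` with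
`σ₁(u)` of order `3` or `6` ⇒ `σ₂ = g σ₁ g⁻¹` with `g ∈ Sp₄(𝔽₂)`: "since the trace of
`ρ̄_f(Frob_p)` equals that of `A`, we see that the two residual images are isomorphic … (there are two
embeddings of `S₃ ≀ C₂` into `GSp₄(𝔽₂)` up to inner automorphisms, and they differ in the trace of
order `3` and `6` elements)". [cite: BrumerEtAl2019, §7.2 p. 1190, (5.1.8) p. 1173, Lemma 5.1.7 p. 1174] -/
theorem exists_conj_of_ker_iff_of_range_S3wrS2 (σ₁ σ₂ : Γ →* GL (Fin 4) (ZMod 2))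
    (h₁ : ∃ g₁ : Perm (Fin 6), σ₁.range =
      ((Subgroup.closure (Set.range gensS3wrS2)).map (MulAut.conj g₁).toMonoidHom).map iotaGL)
    (hSp₂ : σ₂.range ≤ iotaGL.range)
    (hker : ∀ γ, σ₁ γ = 1 ↔ σ₂ γ = 1) {u : Γ} (hu6 : σ₁ u ^ 6 = 1) (hu2 : σ₁ u ^ 2 ≠ 1)
    (htr : Matrix.trace (σ₁ u : Matrix (Fin 4) (Fin 4) (ZMod 2)) =
      Matrix.trace (σ₂ u : Matrix (Fin 4) (Fin 4) (ZMod 2))) :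
    ∃ π : Perm (Fin 6), ∀ γ, σ₂ γ = iotaGL π * σ₁ γ * (iotaGL π)⁻¹ := by
  obtain ⟨g₁, h₁⟩ := h₁
  have hSp₁ : σ₁.range ≤ iotaGL.range := by rw [h₁]; exact Subgroup.map_le_range _ _
  set τ₁ := permLift σ₁ hSp₁ with hτ₁
  set τ₂ := permLift σ₂ hSp₂ with hτ₂
  have hker' : ∀ γ, τ₁ γ = 1 ↔ τ₂ γ = 1 := fun γ => by
    rw [hτ₁, hτ₂, permLift_eq_one_iff, permLift_eq_one_iff]; exact hker γ
  have T := map_eq_iff_of_ker_iff hker'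
  have hrange : τ₁.range = (Subgroup.closure (Set.range gensS3wrS2)).map (MulAut.conj g₁).toMonoidHom :=
    range_permLift_eq σ₁ hSp₁ h₁
  -- normalise `τ₁` so that its image is `W` itself
  set τ₁' := conjHom g₁⁻¹ τ₁ with hτ₁'
  have hid : (MulAut.conj g₁⁻¹).toMonoidHom.comp (MulAut.conj g₁).toMonoidHom =
      MonoidHom.id (Perm (Fin 6)) := by
    ext x
    simp only [MonoidHom.coe_comp, Function.comp_apply, MulEquiv.coe_toMonoidHom, MulAut.conj_apply,
      MonoidHom.id_apply]
    group
  have hrange' : τ₁'.range = Subgroup.closure (Set.range gensS3wrS2) := by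
    rw [hτ₁', conjHom, ← MonoidHom.map_range, hrange, Subgroup.map_map, hid, Subgroup.map_id]
  have hker'' : ∀ γ, τ₁' γ = 1 ↔ τ₂ γ = 1 := fun γ => by
    rw [hτ₁', conjHom_eq_one_iff]; exact hker' γ
  -- the datum at `u`
  have hu6₁ : τ₁ u ^ 6 = 1 := by rw [← map_pow, hτ₁, permLift_eq_one_iff, map_pow]; exact hu6
  have hu2₁ : τ₁ u ^ 2 ≠ 1 := fun h => hu2 (by
    rw [← map_pow]; exact (permLift_eq_one_iff σ₁ hSp₁ (u ^ 2)).1 (by rw [map_pow]; exact h))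
  have hu6₂ : τ₂ u ^ 6 = 1 := by
    have h := (T (u ^ 6) 1).1 (by rw [map_pow, map_one]; exact hu6₁)
    rwa [map_pow, map_one] at h
  have hu2₂ : τ₂ u ^ 2 ≠ 1 := fun h => hu2₁ (by
    have h' := (T (u ^ 2) 1).2 (by rw [map_pow, map_one]; exact h)
    rwa [map_pow, map_one] at h')
  have htr' : (((Finset.univ.filter fun x => τ₁ u x = x).card : ℕ) : ZMod 2) =
      (((Finset.univ.filter fun x => τ₂ u x = x).card : ℕ) : ZMod 2) := by
    rw [← trace_iota_eq_card_fixed, ← trace_iota_eq_card_fixed, hτ₁, hτ₂, iota_permLift,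
      iota_permLift]
    exact htr
  have hfix : (∃ z, τ₁ u z = z) ↔ (∃ z, τ₂ u z = z) := by
    rw [exists_fixed_iff_card_fixed_odd₆ (τ₁ u) hu6₁ hu2₁,
      exists_fixed_iff_card_fixed_odd₆ (τ₂ u) hu6₂ hu2₂, htr']
  have hu6' : τ₁' u ^ 6 = 1 := by rw [hτ₁', conjHom_apply, conj_pow, hu6₁, conj_eq_one_iff]
  have hu2' : τ₁' u ^ 2 ≠ 1 := by rw [hτ₁', conjHom_apply, conj_pow, Ne, conj_eq_one_iff]; exact hu2₁
  have hfix' : (∃ z, τ₁' u z = z) ↔ (∃ z, τ₂ u z = z) := by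
    rw [hτ₁', conjHom_apply, exists_fixed_conj_iff]; exact hfix
  obtain ⟨π, hπ⟩ := exists_conj_of_ker_iff_of_range_eq_S3wrS2 hker'' hrange' hu6' hu2' hfix'
  refine ⟨π * g₁⁻¹, conj_of_permLift_conj σ₁ σ₂ hSp₁ hSp₂ fun γ => ?_⟩
  have hγ := hπ γ
  rw [hτ₁', conjHom_apply] at hγ
  rw [← hτ₁, ← hτ₂, hγ]
  group

end MatrixLevel

end Literature.NumberTheory.FaltingsSerre.GSp4F2
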